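import Literature.NumberTheory.GaloisRepresentations.IdeleBarKSInflation
import Literature.NumberTheory.GaloisRepresentations.IdeleProjectionSTrunc
import Literature.NumberTheory.GaloisRepresentations.HomDualIdeleReadout
import HarnessLib

/-!
# The `S`-readout of `Hom_{G_S}(X, I_S)` through `f ↦ f♯`, I: functoriality, descent, truncation
# (Harari, *Galois Cohomology and CFT*, §17.4 (17.1), Prop. 17.26; Milne ADT I Lemma 4.13 for `G_S`)

Topic `NumberTheory/GaloisRepresentations`; namespace `Literature.NumberTheory.GaloisRepresentations.IdeleClassBar`;
sequel to `IdeleBarKSInflation.lean` (`inflKS`, `sharp K S f = f♯ : Inf X ⟶ J̄`, `sharp_injective`,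
`finIdelePi_sharp_of_not_mem`), `IdeleProjectionSTrunc.lean` (`finIdelePi_truncBar_of_mem/_of_not_mem`,
`archIdelePi_truncBar`), `IdeleTruncationLimit.lean` (`truncBar`, `truncBar_mem_truncIdeleBar`) and door-c6's
`HomDualIdeleReadout.lean` (`readoutInvariant`).  Plumbing definitions with bodies (`sharpHom`, `descendTrunc(AddHom)`,
`truncSharp(AddHom)`) and theorems; NO named fact, no `sorry`, no instance, no notation; number fields in `Type`.

THE MATHEMATICS (Harari Prop. 17.26 = Milne I Lemma 4.13 for `G_S`: `Ext¹_{G_S}(M^D, I_S) ≅ P¹_S(K, M)`, at the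
level of homomorphisms).  `K` a number field, `S` a finite set of finite places, `N_S ≤ Γ_K` the ramification
subgroup, `G_S = Γ_K ⧸ N_S`, `I_S = truncIdeleBar K S ≤ J̄` Harari's truncated idèles (a discrete `G_S`-module,
`truncIdeleBarD K S`), `π_v : J̄ → K̄_vˣ` door-c6's idèle projections (`ideleProjection K v`, every place `v`).
For `X ∈ C_{G_S}` and `f : X ⟶ I_S` the inflated morphism `f♯ : Inf X ⟶ J̄` is read by door-c6's
`readoutInvariant (π_v) (Inf X) f♯ ∈ Hom_ℤ(X|_v, K̄_vˣ)^{Γ_{K_v}}`.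
* **Functoriality** (§0): `(f + g)♯ = f♯ + g♯` (`sharpHom`), `(i ≫ f)♯ = Inf i ≫ f♯` (`sharp_comp`, the companion lemma
  for module morphisms), `f♯ = Inf f ≫ ι_S` with `ι_S := (𝟙 I_S)♯ : Inf I_S ⟶ J̄`.
* **Descent** (§1): an additive `g : X → J̄`, `Γ_K`-equivariant through `G_S` and valued in `I_S`, IS a `G_S`-morphism
  `descendTrunc g : X ⟶ I_S` with `(descendTrunc g)♯ = g` on vectors.
* **Truncation** (§2): for any `C_Γ`-morphism `f₀ : Inf X ⟶ J̄` the values are `N_S`-invariant, so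
  `trunc ∘ f₀` is valued in `I_S = trunc(J̄^{N_S})` and descends: `truncSharp f₀ : X ⟶ I_S`, whose `♯` has the SAME
  readout invariants as `f₀` at `v ∈ S` and at the infinite places, and readout `0` at the finite `v ∉ S`;
  `truncSharp (f♯) = f`.
The sequel `IdeleBarKSInflationAssembly.lean` draws (R3)_S (assembly) and uniqueness from these and door-c6's
all-places theorems.

Written for lane «PT-Ш-S-TC» (brick D4b, step F2b′ of `D3-SCOPING-w6g10.md` §6) of crux `GoodLatticeBDPValue`
(cell bsd-eis, item 19032), seat bsd-line-x1-p1-w6 gen 11.  HONEST FRAMING: bookkeeping at the level of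
homomorphisms; no arithmetic duality statement and no case of BSD is proved here.

## References
* D. Harari, *Galois Cohomology and Class Field Theory*, Universitext, Springer (2020), §17.4 (17.1), Prop. 17.26
  (proof), §4.3 Remark 4.24, Lemma 15.39. [Harari2020]
* J. S. Milne, *Arithmetic Duality Theorems*, 2nd ed. (2006), I Lemma 4.13 (proof). [MilneADT2006]
* J. W. S. Cassels, A. Fröhlich (eds.), *Algebraic Number Theory* (1967), Ch. VII (J. Tate) §7.3, §8 Prop. 8.1.
  [CasselsFrohlichANT1967]
-/

noncomputable section

open NumberField NumberField.InfinitePlace IsDedekindDomain CategoryTheory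
open Field (absoluteGaloisGroup)
open Literature.NumberTheory.Automorphic Literature.Algebra.Homology Literature.Algebra.Homology.DiscreteRep
open scoped Classical

namespace Literature.NumberTheory.GaloisRepresentations

namespace IdeleClassBar

open IdeleReadout HomDual DGMBridge DiscreteGaloisModule

variable {K : Type} [Field K] [NumberField K] {S : Finset (HeightOneSpectrum (𝓞 K))}
variable {X : DiscreteRepCat ℤ (GaloisGroupUnramifiedOutside K (↑S : Set (HeightOneSpectrum (𝓞 K))))}

/-! ## §0. `f ↦ f♯` is additive and natural in `X` (module-morphism companions) -/

section Functorial

/-- **`(f + g)♯ = f♯ + g♯`.** [cite: Harari2020, Prop. 17.26 (proof)] -/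
theorem sharp_add (f g : X ⟶ truncIdeleBarD K S) : sharp K S (f + g) = sharp K S f + sharp K S g := by
  apply ObjectProperty.hom_ext
  apply Rep.hom_ext
  refine DFunLike.ext _ _ fun x => ?_
  change (sharp K S (f + g)).hom.hom x = (sharp K S f).hom.hom x + (sharp K S g).hom.hom x
  rw [sharp_hom_apply, sharp_hom_apply, sharp_hom_apply]
  rfl

/-- **`0♯ = 0`.** [cite: Harari2020, Prop. 17.26 (proof)] -/
theorem sharp_zero : sharp K S (0 : X ⟶ truncIdeleBarD K S) = 0 := by
  apply ObjectProperty.hom_ext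
  apply Rep.hom_ext
  refine DFunLike.ext _ _ fun x => ?_
  change (sharp K S (0 : X ⟶ truncIdeleBarD K S)).hom.hom x = 0
  rw [sharp_hom_apply]
  rfl

variable (K S X) in
/-- **`f ↦ f♯` as an additive map `Hom_{G_S}(X, I_S) →+ Hom_{Γ_K}(Inf X, J̄)`.** [cite: Harari2020, Prop. 17.26 (proof)] -/
def sharpHom : (X ⟶ truncIdeleBarD K S) →+ ((inflKS K S).obj X ⟶ ideleBarD K) where
  toFun := sharp K S
  map_zero' := sharp_zero
  map_add' := sharp_add

/-- Unfolding. [cite: Harari2020, Prop. 17.26 (proof)] -/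
@[simp] theorem sharpHom_apply (f : X ⟶ truncIdeleBarD K S) : sharpHom K S X f = sharp K S f := rfl

/-- `sharpHom` is injective. [cite: Harari2020, Prop. 17.26 (proof)] -/
theorem sharpHom_injective : Function.Injective (sharpHom K S X) := sharp_injective

/-- **Naturality in `X`: `(i ≫ f)♯ = Inf i ≫ f♯`** (the companion lemma for kernel-monotone module morphisms).
[cite: Harari2020, Prop. 17.26 (proof), §4.3 Remark 4.24] -/
theorem sharp_comp {X' : DiscreteRepCat ℤ (GaloisGroupUnramifiedOutside K (↑S : Set (HeightOneSpectrum (𝓞 K))))}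
    (i : X' ⟶ X) (f : X ⟶ truncIdeleBarD K S) : sharp K S (i ≫ f) = (inflKS K S).map i ≫ sharp K S f := by
  apply ObjectProperty.hom_ext
  apply Rep.hom_ext
  refine DFunLike.ext _ _ fun x => ?_
  change (sharp K S (i ≫ f)).hom.hom x = (sharp K S f).hom.hom (((inflKS K S).map i).hom.hom x)
  rw [sharp_hom_apply, sharp_hom_apply, DiscreteRep.inflQuotFunctor_map_hom_hom]
  rfl

/-- **`f♯ = Inf f ≫ (𝟙_{I_S})♯`**: `f♯` factors through the inflated inclusion `ι_S := (𝟙 I_S)♯ : Inf I_S ⟶ J̄`.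
[cite: Harari2020, Prop. 17.26 (proof)] -/
theorem sharp_eq_map_comp_sharp_id (f : X ⟶ truncIdeleBarD K S) :
    sharp K S f = (inflKS K S).map f ≫ sharp K S (𝟙 (truncIdeleBarD K S)) := by
  rw [← sharp_comp, Category.comp_id]

/-- The inflated inclusion `ι_S = (𝟙 I_S)♯ : Inf I_S ⟶ J̄` on vectors is the subtype inclusion `I_S ≤ J̄`.
[cite: Harari2020, §17.4 (17.1)] -/
theorem sharp_id_hom_apply (z : (truncIdeleBarD K S).obj.V) :
    (sharp K S (𝟙 (truncIdeleBarD K S))).hom.hom z = Subtype.val z := rfl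

end Functorial

/-! ## §1. Descent: a `Γ_K`-equivariant `g : X → J̄` valued in `I_S` is a `G_S`-morphism `X ⟶ I_S` -/

section Descent

variable (g : X.obj.V →+ (ideleData K).toSystem.limit)
  (hrep : ∀ (σ : absoluteGaloisGroup K) (x : X.obj.V),
    g (X.obj.ρ (QuotientGroup.mk σ) x) = (ideleData K).toSystem.rep σ (g x))
  (hmem : ∀ x : X.obj.V, g x ∈ truncIdeleBar K S)

/-- The corestriction `X → I_S` of `g` (additive). [cite: Harari2020, Prop. 17.26 (proof)] -/
def descendTruncAddHom : X.obj.V →+ truncIdeleBar K S :=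
  AddMonoidHom.mk' (fun x => ⟨g x, hmem x⟩) fun x y => Subtype.ext (map_add g x y)

/-- Formula. [cite: Harari2020, Prop. 17.26 (proof)] -/
@[simp] theorem coe_descendTruncAddHom_apply (x : X.obj.V) :
    ((descendTruncAddHom g hmem x : truncIdeleBar K S) : (ideleData K).toSystem.limit) = g x := rfl

/-- **Descent**: an additive `g : X → J̄` which is `Γ_K`-equivariant for the inflated action (`Γ_K` acting on `X`
through `G_S`) and takes values in `I_S` is a `G_S`-morphism `X ⟶ I_S` (`N_S` acts trivially on both sides, so
`Γ_K`-equivariance IS `G_S`-equivariance). [cite: Harari2020, Prop. 17.26 (proof), §4.3 Remark 4.24]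
[cite: CasselsFrohlichANT1967, Ch. VII §8 Prop. 8.1] -/
def descendTrunc : X ⟶ truncIdeleBarD K S :=
  letI : Module ℤ X.obj.V := X.obj.hV2
  ObjectProperty.homMk (Rep.ofHom
    ⟨{ toFun := descendTruncAddHom g hmem
       map_add' := fun x y => map_add _ x y
       map_smul' := fun c x => by
         have h := map_intCast_smul (descendTruncAddHom g hmem) ℤ ℤ c x
         rw [RingHom.id_apply]
         exact h },
      fun γ => LinearMap.ext fun x => by
        induction γ using QuotientGroup.induction_on with
        | H σ =>
          apply Subtype.ext
          change g (X.obj.ρ (QuotientGroup.mk σ) x) =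
            ((truncIdeleBarRepr K S (QuotientGroup.mk σ) (descendTruncAddHom g hmem x) : truncIdeleBar K S) :
              (ideleData K).toSystem.limit)
          rw [coe_truncIdeleBarRepr_mk_apply, coe_descendTruncAddHom_apply]
          exact hrep σ x⟩)

/-- Formula: the underlying element of `J̄` of `descendTrunc g x` is `g x`. [cite: Harari2020, Prop. 17.26 (proof)] -/
@[simp] theorem coe_descendTrunc_hom_apply (x : X.obj.V) :
    Subtype.val ((descendTrunc g hrep hmem).hom.hom x) = g x := rfl

/-- **`(descendTrunc g)♯ = g` on vectors.** [cite: Harari2020, Prop. 17.26 (proof)] -/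
@[simp] theorem sharp_descendTrunc_hom_apply (x : X.obj.V) :
    (sharp K S (descendTrunc g hrep hmem)).hom.hom x = g x := by
  rw [sharp_hom_apply]
  rfl

end Descent

/-! ## §2. Truncating a `C_Γ`-morphism `f₀ : Inf X ⟶ J̄` to a `G_S`-morphism `X ⟶ I_S` -/

section Trunc

variable (f₀ : (inflKS K S).obj X ⟶ ideleBarD K)

/-- **The values of a `C_Γ`-morphism out of an inflated `G_S`-object are `N_S`-invariant.**
[cite: Harari2020, §4.3 Remark 4.24, §17.4 (17.1)] -/
theorem rep_hom_eq_self_of_mem_ramificationSubgroup {σ : absoluteGaloisGroup K}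
    (hσ : σ ∈ ramificationSubgroup K (↑S : Set (HeightOneSpectrum (𝓞 K)))) (x : X.obj.V) :
    (ideleData K).toSystem.rep σ (f₀.hom.hom x) = f₀.hom.hom x := by
  have h := (Rep.hom_comm_apply f₀.hom σ x).symm
  have h1 : (QuotientGroup.mk σ : GaloisGroupUnramifiedOutside K (↑S : Set (HeightOneSpectrum (𝓞 K)))) = 1 :=
    (QuotientGroup.eq_one_iff σ).mpr hσ
  have h2 : ((inflKS K S).obj X).obj.ρ σ x = x := by
    change X.obj.ρ (QuotientGroup.mk σ) x = x
    rw [h1, map_one]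
    rfl
  rw [h2] at h
  exact h

/-- `trunc ∘ f₀` (additive). [cite: Harari2020, §17.4 (17.1), Prop. 17.26 (proof)] -/
def truncSharpAddHom : X.obj.V →+ (ideleData K).toSystem.limit :=
  (truncBar K S).comp (f₀.hom.hom : ((inflKS K S).obj X).obj.V →+ (ideleBarD K).obj.V)

/-- Formula. [cite: Harari2020, Prop. 17.26 (proof)] -/
@[simp] theorem truncSharpAddHom_apply (x : X.obj.V) :
    truncSharpAddHom f₀ x = truncBar K S (f₀.hom.hom x) := rfl

/-- `trunc ∘ f₀` is `Γ_K`-equivariant (through `G_S` on the source). [cite: Harari2020, §17.4 (17.1)] -/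
theorem truncSharpAddHom_rep (σ : absoluteGaloisGroup K) (x : X.obj.V) :
    truncSharpAddHom f₀ (X.obj.ρ (QuotientGroup.mk σ) x) = (ideleData K).toSystem.rep σ (truncSharpAddHom f₀ x) := by
  rw [truncSharpAddHom_apply, truncSharpAddHom_apply, ← truncBar_rep]
  exact congrArg (truncBar K S) (Rep.hom_comm_apply f₀.hom σ x)

/-- `trunc ∘ f₀` takes values in `I_S = trunc (J̄^{N_S})`. [cite: Harari2020, §17.4 (17.1)] -/
theorem truncSharpAddHom_mem (x : X.obj.V) : truncSharpAddHom f₀ x ∈ truncIdeleBar K S :=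
  truncBar_mem_truncIdeleBar fun _ hσ => rep_hom_eq_self_of_mem_ramificationSubgroup f₀ hσ x

/-- **The truncation `X ⟶ I_S` of `f₀ : Inf X ⟶ J̄`** (descent of `trunc ∘ f₀`).
[cite: Harari2020, §17.4 (17.1), Prop. 17.26 (proof)] [cite: MilneADT2006, I Lemma 4.13 (proof)] -/
def truncSharp : X ⟶ truncIdeleBarD K S :=
  descendTrunc (truncSharpAddHom f₀) (truncSharpAddHom_rep f₀) (truncSharpAddHom_mem f₀)

/-- **`(truncSharp f₀)♯ = trunc ∘ f₀` on vectors.** [cite: Harari2020, Prop. 17.26 (proof)] -/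
@[simp] theorem sharp_truncSharp_hom_apply (x : X.obj.V) :
    (sharp K S (truncSharp f₀)).hom.hom x = truncBar K S (f₀.hom.hom x) :=
  sharp_descendTrunc_hom_apply _ _ _ x

/-- `π_v ∘ (truncSharp f₀)♯ = π_v ∘ f₀` at a finite place `v ∈ S`. [cite: Harari2020, Prop. 17.26 (proof)] -/
theorem finIdelePi_sharp_truncSharp_of_mem {v : HeightOneSpectrum (𝓞 K)} (hv : v ∈ S) (x : X.obj.V) :
    finIdelePi v ((sharp K S (truncSharp f₀)).hom.hom x) = finIdelePi v (f₀.hom.hom x) := by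
  rw [sharp_truncSharp_hom_apply, finIdelePi_truncBar_of_mem K S hv]

/-- `π_v ∘ (truncSharp f₀)♯ = 0` at a finite place `v ∉ S`. [cite: Harari2020, Lemma 15.39, Prop. 17.26 (proof)] -/
theorem finIdelePi_sharp_truncSharp_of_not_mem {v : HeightOneSpectrum (𝓞 K)} (hv : v ∉ S) (x : X.obj.V) :
    finIdelePi v ((sharp K S (truncSharp f₀)).hom.hom x) = 0 := by
  rw [sharp_truncSharp_hom_apply, finIdelePi_truncBar_of_not_mem K S hv]

/-- `π_v ∘ (truncSharp f₀)♯ = π_v ∘ f₀` at an infinite place. [cite: Harari2020, Prop. 17.26 (proof)] -/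
theorem archIdelePi_sharp_truncSharp (v : InfinitePlace K) (x : X.obj.V) :
    archIdelePi v ((sharp K S (truncSharp f₀)).hom.hom x) = archIdelePi v (f₀.hom.hom x) := by
  rw [sharp_truncSharp_hom_apply, archIdelePi_truncBar]

/-- **`truncSharp (f♯) = f`** (truncation is the identity on `I_S`). [cite: Harari2020, §17.4 (17.1)] -/
theorem truncSharp_sharp (f : X ⟶ truncIdeleBarD K S) : truncSharp (sharp K S f) = f := by
  apply sharp_injective
  apply ObjectProperty.hom_ext
  apply Rep.hom_ext
  refine DFunLike.ext _ _ fun x => ?_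
  rw [sharp_truncSharp_hom_apply, sharp_hom_apply]
  exact truncBar_eq_self_of_mem (f.hom.hom x).2

variable [Module.Finite ℤ (LCarrier ((inflKS K S).obj X))]

/-- **Readout invariant of `(truncSharp f₀)♯` at a finite `v ∈ S` = that of `f₀`.** [cite: Harari2020, Prop. 17.26 (proof)]
[cite: MilneADT2006, I Lemma 4.13 (proof)] -/
theorem readoutInvariant_sharp_truncSharp_inr_of_mem {v : HeightOneSpectrum (𝓞 K)} (hv : v ∈ S) :
    readoutInvariant (ideleProjection K (Sum.inr v)) ((inflKS K S).obj X) (sharp K S (truncSharp f₀)) =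
      readoutInvariant (ideleProjection K (Sum.inr v)) ((inflKS K S).obj X) f₀ := by
  refine Subtype.ext (LinearMap.ext fun x => ?_)
  rw [coe_readoutInvariant, coe_readoutInvariant, readoutMap_apply, readoutMap_apply,
    ideleProjection_inr_toAddMonoidHom]
  exact finIdelePi_sharp_truncSharp_of_mem f₀ hv _

/-- **Readout invariant of `(truncSharp f₀)♯` at a finite `v ∉ S` is `0`.** [cite: Harari2020, Lemma 15.39, Prop. 17.26 (proof)] -/
theorem readoutInvariant_sharp_truncSharp_inr_of_not_mem {v : HeightOneSpectrum (𝓞 K)} (hv : v ∉ S) :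
    readoutInvariant (ideleProjection K (Sum.inr v)) ((inflKS K S).obj X) (sharp K S (truncSharp f₀)) = 0 := by
  refine Subtype.ext (LinearMap.ext fun x => ?_)
  rw [coe_readoutInvariant, readoutMap_apply, ideleProjection_inr_toAddMonoidHom]
  exact finIdelePi_sharp_truncSharp_of_not_mem f₀ hv _

/-- **Readout invariant of `(truncSharp f₀)♯` at an infinite place = that of `f₀`.** [cite: Harari2020, Prop. 17.26 (proof)]
[cite: MilneADT2006, I Lemma 4.13 (proof)] -/
theorem readoutInvariant_sharp_truncSharp_inl (v : InfinitePlace K) :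
    readoutInvariant (ideleProjection K (Sum.inl v)) ((inflKS K S).obj X) (sharp K S (truncSharp f₀)) =
      readoutInvariant (ideleProjection K (Sum.inl v)) ((inflKS K S).obj X) f₀ := by
  refine Subtype.ext (LinearMap.ext fun x => ?_)
  rw [coe_readoutInvariant, coe_readoutInvariant, readoutMap_apply, readoutMap_apply,
    ideleProjection_inl_toAddMonoidHom]
  exact archIdelePi_sharp_truncSharp f₀ v _

end Trunc

end IdeleClassBar

end Literature.NumberTheory.GaloisRepresentations

end
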